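import Summits.BirchSwinnertonDyer.BirchSwinnertonDyer.Theorems.ErratumRoadFiveControlFromJSWMult
import HarnessLib

/-!
# Route `ErratumRoadFive` (rung K2), crux `Rest3NoWitnessBranchAtFive` (item stmt-BirchSwinnertonDyer-19703), stub
# `stub_nw_offLocus` — PER-PAIR TOOL for its rungs: the TAMAGAWA-SLACK HEEGNER-INDEX CERTIFICATE. At an X11b pair with a
# (ram) witness, ONE odd Heegner datum whose Heegner index satisfies `ord_p [E(K):ℤP] ≤ ord_p ∏_ℓ c_ℓ(E)` gives the lower
# half of `BSD(E,p)` and hence route p2's open input `P2OpenInputOnTreeAt W p` — NO Kolyvagin prime, NO `p`-adic regulator,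
# NO preprint (cell `bsd-stepL`, ACCEL seat `bsd-stepL-nw1` g0; `--supports stmt-BirchSwinnertonDyer-19703`; Theses-FREE)

HONEST FRAMING. THEOREMS ONLY (no definition, no named fact, no `sorry`); bookkeeping over multr1-p2's rigidity
(`indexLowerBoundAt_iff_missingLowerBoundAt_of_heegnerData_of_odd`) and imc-p1's one-sided tightness
(`openInputOnTreeAt_of_missingLowerBoundAt_of_ram`); every published named fact is a HYPOTHESIS; the index inequality
`hidx` is a per-pair CERTIFICATE binder (a finite computation: the Heegner point's index in `E(K)` at ONE field), never
asserted here. BSD is proved for no pair; nothing is booked; no census word moves (T7).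

WHY (seat nw1's reading of the off-Locus stub, memo OFFLOCUS-NW-ROADS.md on item 19703): off the Locus (`p ∣ ∏ c_ℓ`,
`t := ord_p ∏ c_ℓ ≥ 1`) the mod-`p` Kolyvagin certificate of the Locus road is void (every `c_1(n)` vanishes), and the
class-wide supplier is W. Zhang's refined non-vanishing `M_∞ ≤ t` (OPEN at `p ∥ N`; companion file
`ErratumRoadFiveRest3NoWitnessOffLocusKolyvaginTam.lean`). AT A PAIR, however, STEP L
`2·ord_p[E(K):ℤP] ≤ ord_p #Ш(E/K) + 2t` holds TRIVIALLY as soon as `ord_p[E(K):ℤP] ≤ t` (since `ord_p #Ш(E/K) ≥ 0`) —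
granted BSD this is exactly the case `Ш(E/K)[p] = 0` — and STEP L at ONE odd datum of a (ram) pair IS the lower half of
`BSD(E,p)` (rigidity), which gives the open input at EVERY datum (tightness). Example of record (rest-p2 kit j255090):
`(5595f1, 5)`, `ord₅ [E(K):ℤy_K] = 1 = ord₅ c₃` at `d_K = −59` — the pair where the Locus-style index certificate
(`p ∤ [E(K):ℤy_K]`) provably fails; this tool reads the same computation as a SUCCESSFUL certificate. It is a second,
PARI-independent certificate road for the off-Locus rungs next to the cyclotomic lever's regulator certificate
(rest-p2's `rung_5595f1_of_regCert`).

* `missingLowerBoundAt_of_slackIndexAt` — datum level: X11b ∧ (ram) pair, odd Heegner datum (`d_K` odd, Heegner for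
  `N_E`, `p ∤ c`, `p ∤ #𝓞_K^×`, `L(E^{d_K},1) ≠ 0`, a minimal twist model) with `ord_p [E(K):ℤP] ≤ ord_p ∏ c_ℓ(E)` ⟹
  `Typed.MissingLowerBoundAt W p`.
* `openInputOnTreeAt_of_slackIndexAt` — the same + the control identity `P2ControlOnTreeAt W p` ⟹ `P2OpenInputOnTreeAt W p`;
  `openInputOnTreeAt_of_slackIndexAt_of_thm331Mult` — control by citation (JSW17 Thm. 3.3.1-mult).

References: [JetchevSkinnerWan2017] §7.4.1 (eq:shalowerK-1), Thm. 3.3.1; [Castella2018] (1.1), Thm. 2.3; [Skinner2016PacificMC]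
Thm. C; [GrossZagier1986] V §2; [McCallumLMS1991] §1, Lemma 5.1.
-/

-- the Theorems namespace of this sub repeats the summit name by design (D-0017 nested layout)
set_option linter.dupNamespace false

noncomputable section

open scoped Classical

namespace Summit.BirchSwinnertonDyer.BirchSwinnertonDyer.Theorems

open WeierstrassCurve NumberField Literature.NumberTheory.EllipticCurves
  Literature.NumberTheory.EllipticCurves.ModularForms
  Literature.NumberTheory.EllipticCurves.Rank1Residual
  Literature.NumberTheory.EllipticCurves.Rank1Residual.Typed
  Summit.BirchSwinnertonDyer.Rank1Residual Summit.BirchSwinnertonDyer.Rank1Residual.X11b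

/-- **The Tamagawa-slack Heegner-index certificate gives the lower half of `BSD(E,p)`** (datum level). For `(E,p)` in
X11b (`r_an = 1`, `p ∥ N` odd, `E[p]` irreducible) with a (ram) witness, and ONE odd Heegner datum — `K` imaginary
quadratic with `d_K` odd, every `ℓ ∣ N_E` split, `p ∤ #𝓞_K^×`, `L(E^{d_K},1) ≠ 0`, a parametrisation datum `Dt` of
level `N_E` with `p ∤ c`, its Heegner point `P ∈ E(K)`, a globally minimal model `Wd` of the twist —: IF
`ord_p [E(K):ℤP] ≤ ord_p ∏_ℓ c_ℓ(E)` (`hidx`, the CERTIFICATE), THEN `Typed.MissingLowerBoundAt W p`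
(`ord_p #Ш(E)_an ≤ ord_p #Ш(E)`). Proof: `Ш(E/K)` is finite (Kolyvagin at the non-torsion Heegner point — Gross–Zagier),
so STEP L `IndexLowerBoundAt W p K P` (`2·ord_p[E(K):ℤP] ≤ ord_p #Ш(E/K) + 2·ord_p ∏ c_ℓ`) holds trivially from `hidx`,
and multr1-p2's rigidity `indexLowerBoundAt_iff_missingLowerBoundAt_of_heegnerData_of_odd` (Gross–Zagier bookkeeping +
Skinner 2016 Thm. C for the twist, where (ram) is used) turns it into the lower half. CONDITIONAL on the named facts
(`hGZ hKo hSk hGZK hmod`) and on `hidx`; nothing booked. [cite: JetchevSkinnerWan2017, §7.4.1 (eq:shalowerK-1) (arXiv:1512.06894 p. 30)]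
[cite: Skinner2016PacificMC, Thm. C (§1) and footnote 1] [cite: Kolyvagin1990, Thm. A] [cite: Miller2011LMS, Def. 1.1] -/
theorem missingLowerBoundAt_of_slackIndexAt
    (W : WeierstrassCurve ℚ) [W.IsElliptic] [W.IsGloballyMinimal] (p : ℕ) [Fact p.Prime]
    [NeZero (W.conductorNorm ℤ)] (K : Type) [Field K] [NumberField K]
    (Dt : ModularParametrizationData W (W.conductorNorm ℤ))
    (H : HeegnerDatum (W.conductorNorm ℤ) (NumberField.discr K)) (ι : K →+* ℂ)
    (P : (W.baseChange K).toAffine.Point)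
    -- published named facts
    (hGZ : gross_zagier (W.conductorNorm ℤ) W K) (hKo : kolyvagin (W.conductorNorm ℤ) W K)
    (hSk : Skinner2016.thmC_padicValRat_bsd_rank_zero)
    (hGZK : rank_eq_analyticRank_of_analyticRank_le_one) (hmod : hasEntireLFunction_rat)
    -- the pair
    (hX : ClassX11b W p) (hram : Ram W p)
    -- ONE odd Heegner datum
    (hK : IsImaginaryQuadratic K) (hodd : Odd (NumberField.discr K))
    (hHN : SatisfiesHeegnerHypothesis (W.conductorNorm ℤ) K)
    (hP : WeierstrassCurve.Affine.Point.map ι.toRatAlgHom P = heegnerPointComplex Dt H)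
    (hc : ¬ (p : ℤ) ∣ Dt.c) (hμ : ¬ p ∣ Units.torsionOrder K)
    (hLt : (W.quadraticTwist (NumberField.discr K : ℚ)).entireLFunction 1 ≠ 0)
    (Wd : WeierstrassCurve ℚ) [Wd.IsElliptic] [Wd.IsGloballyMinimal] (Cd : VariableChange ℚ)
    (hWd : Cd • W.quadraticTwist (NumberField.discr K : ℚ) = Wd)
    -- THE CERTIFICATE: the Heegner index is absorbed by the Tamagawa exponent
    (hidx : padicValNat p (AddSubgroup.zmultiples P).index ≤ padicValNat p W.tamagawaProduct) :
    Typed.MissingLowerBoundAt W p := by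
  obtain ⟨hr, hp2, hmult, hirr⟩ := hX
  have hPinf : ¬ IsOfFinAddOrder P :=
    not_isOfFinAddOrder_of_heegner_of_analyticRank_eq_one W (W.conductorNorm ℤ) K Dt H ι P hGZ hmod hr hK hHN hLt
      hP
  haveI : Finite (W.baseChange K).sha := (hKo hK hHN ⟨Dt, H, ι, hP⟩ hPinf).2
  have hL : IndexLowerBoundAt W p K P := by
    unfold IndexLowerBoundAt
    omega
  exact (indexLowerBoundAt_iff_missingLowerBoundAt_of_heegnerData_of_odd W p K Dt H ι P hGZ hKo hSk hGZK hmod hr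
    hp2 hmult hirr hram hK hodd hHN hP hc hμ hLt Wd Cd hWd).1 hL

/-- **The Tamagawa-slack Heegner-index certificate gives route p2's OPEN INPUT at the pair** (every datum), given
the control identity `P2ControlOnTreeAt W p` (PUB shape): §1 + imc-p1's one-sided tightness
`openInputOnTreeAt_of_missingLowerBoundAt_of_ram`. Per-pair rung tool for the off-Locus stubs of cruxes 19703 ∕ 19624
(and for any (ram) pair): the certificate is ONE Heegner-index computation at ONE odd Heegner field. CONDITIONAL on the
named facts, on `hC` and on `hidx`; nothing booked. [cite: Castella2018, Thm. 2.3 (p. 5), (1.1) (p. 2)]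
[cite: JetchevSkinnerWan2017, §7.4.1 (pp. 30–31)] [cite: Skinner2016PacificMC, Thm. C (§1)] -/
theorem openInputOnTreeAt_of_slackIndexAt
    (W : WeierstrassCurve ℚ) [W.IsElliptic] [W.IsGloballyMinimal] (p : ℕ) [Fact p.Prime]
    [NeZero (W.conductorNorm ℤ)] (K : Type) [Field K] [NumberField K]
    (Dt : ModularParametrizationData W (W.conductorNorm ℤ))
    (H : HeegnerDatum (W.conductorNorm ℤ) (NumberField.discr K)) (ι : K →+* ℂ)
    (P : (W.baseChange K).toAffine.Point)
    (hGZ : ∀ (N : ℕ) [NeZero N] (W : WeierstrassCurve ℚ) (K : Type) [Field K] [NumberField K],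
      gross_zagier N W K)
    (hKo : ∀ (N : ℕ) [NeZero N] (W : WeierstrassCurve ℚ) (K : Type) [Field K] [NumberField K],
      kolyvagin N W K)
    (hSk : Skinner2016.thmC_padicValRat_bsd_rank_zero)
    (hGZK : rank_eq_analyticRank_of_analyticRank_le_one) (hmod : hasEntireLFunction_rat)
    (hC : P2ControlOnTreeAt W p)
    (hX : ClassX11b W p) (hram : Ram W p)
    (hK : IsImaginaryQuadratic K) (hodd : Odd (NumberField.discr K))
    (hHN : SatisfiesHeegnerHypothesis (W.conductorNorm ℤ) K)
    (hP : WeierstrassCurve.Affine.Point.map ι.toRatAlgHom P = heegnerPointComplex Dt H)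
    (hc : ¬ (p : ℤ) ∣ Dt.c) (hμ : ¬ p ∣ Units.torsionOrder K)
    (hLt : (W.quadraticTwist (NumberField.discr K : ℚ)).entireLFunction 1 ≠ 0)
    (Wd : WeierstrassCurve ℚ) [Wd.IsElliptic] [Wd.IsGloballyMinimal] (Cd : VariableChange ℚ)
    (hWd : Cd • W.quadraticTwist (NumberField.discr K : ℚ) = Wd)
    (hidx : padicValNat p (AddSubgroup.zmultiples P).index ≤ padicValNat p W.tamagawaProduct) :
    P2OpenInputOnTreeAt W p :=
  openInputOnTreeAt_of_missingLowerBoundAt_of_ram W p hGZ hKo hSk hGZK hmod hC hram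
    (missingLowerBoundAt_of_slackIndexAt W p K Dt H ι P (hGZ _ W K) (hKo _ W K) hSk hGZK hmod hX hram hK hodd hHN hP
      hc hμ hLt Wd Cd hWd hidx)

/-- **The same with the control identity BY CITATION** (JSW17 Thm. 3.3.1-mult, tree fact
`thm331_anticyclotomicControl_mult`, via imc-t1 ∕ imc-p1's `p2ControlOnTreeAt_of_thm331Mult`). CONDITIONAL on the named
facts and on the certificate `hidx`; nothing booked. [cite: JetchevSkinnerWan2017, Thm. 3.3.1 with §3.5 (3.5.c) (arXiv:1512.06894 pp. 11, 15)]
[cite: Skinner2016PacificMC, Thm. C (§1)] -/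
theorem openInputOnTreeAt_of_slackIndexAt_of_thm331Mult
    (W : WeierstrassCurve ℚ) [W.IsElliptic] [W.IsGloballyMinimal] (p : ℕ) [Fact p.Prime]
    [NeZero (W.conductorNorm ℤ)] (K : Type) [Field K] [NumberField K]
    (Dt : ModularParametrizationData W (W.conductorNorm ℤ))
    (H : HeegnerDatum (W.conductorNorm ℤ) (NumberField.discr K)) (ι : K →+* ℂ)
    (P : (W.baseChange K).toAffine.Point)
    (hGZ : ∀ (N : ℕ) [NeZero N] (W : WeierstrassCurve ℚ) (K : Type) [Field K] [NumberField K],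
      gross_zagier N W K)
    (hKo : ∀ (N : ℕ) [NeZero N] (W : WeierstrassCurve ℚ) (K : Type) [Field K] [NumberField K],
      kolyvagin N W K)
    (hSk : Skinner2016.thmC_padicValRat_bsd_rank_zero)
    (hGZK : rank_eq_analyticRank_of_analyticRank_le_one) (hmod : hasEntireLFunction_rat)
    (h331 : JetchevSkinnerWan2017.thm331_anticyclotomicControl_mult)
    (hX : ClassX11b W p) (hram : Ram W p)
    (hK : IsImaginaryQuadratic K) (hodd : Odd (NumberField.discr K))
    (hHN : SatisfiesHeegnerHypothesis (W.conductorNorm ℤ) K)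
    (hP : WeierstrassCurve.Affine.Point.map ι.toRatAlgHom P = heegnerPointComplex Dt H)
    (hc : ¬ (p : ℤ) ∣ Dt.c) (hμ : ¬ p ∣ Units.torsionOrder K)
    (hLt : (W.quadraticTwist (NumberField.discr K : ℚ)).entireLFunction 1 ≠ 0)
    (Wd : WeierstrassCurve ℚ) [Wd.IsElliptic] [Wd.IsGloballyMinimal] (Cd : VariableChange ℚ)
    (hWd : Cd • W.quadraticTwist (NumberField.discr K : ℚ) = Wd)
    (hidx : padicValNat p (AddSubgroup.zmultiples P).index ≤ padicValNat p W.tamagawaProduct) :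
    P2OpenInputOnTreeAt W p :=
  openInputOnTreeAt_of_slackIndexAt W p K Dt H ι P hGZ hKo hSk hGZK hmod
    (p2ControlOnTreeAt_of_thm331Mult W p h331 hKo) hX hram hK hodd hHN hP hc hμ hLt Wd Cd hWd hidx

end Summit.BirchSwinnertonDyer.BirchSwinnertonDyer.Theorems

end
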